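import Summits.Parity.GeneralizedHardyLittlewood.Theorems.GreenTaoLevelTwoGITwoCyclicInverseTinyBohr
import Summits.Parity.GeneralizedHardyLittlewood.Theorems.GreenTaoLevelTwoGITwoCyclicInverseBracketAggregate
import Summits.Parity.GeneralizedHardyLittlewood.Theorems.GreenTaoLevelTwoGITwoCyclicInverseBohrSmoothing
import Summits.Parity.GeneralizedHardyLittlewood.Theorems.GreenTaoLevelTwoGITwoCyclicInverseCircleCutoff

/-!
# Route `GreenTaoLevelTwo`, crux `GITwo` (stmt-Parity-21275), line `birth`, stub `stub_cyclicInverse`: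
# the localised quadratic correlation in factorised bracket form (GT08a arXiv §12, proof of Thm. 68)

Helper toward the XL stub `stub_cyclicInverse` (B. Green, T. Tao, *An inverse theorem for the Gowers
`U³(G)` norm*, arXiv:math/0503014, Thm. 68 = PEMS 51 (2008) Thm. 12.8).  Block E17, second plumbing step
("Consider the function `∏_{ξ∈S} χ^{1+4d}(ξ·n) − 1_B(n)` … we may assume `φ(n) = ∑ a_{ξξ'}{ξ·n}{ξ'·n} +
∑ a_ξ{ξ·n}`"): on a translate `y + B(S',ρ₆)` of the tiny regular Bohr set of `…TinyBohr` the phase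
`e(cμ(x₀+y+u)(x₀+y+u)) e((y+u)ζ)` splits (`stdAddChar_local_phase_split`) into a constant, a character of
`u`, the linear bracket form `e(cμ(u)·z)` and the quadratic bracket form `e(cμ(u)·u)` (arXiv Prop. 54,
`stdAddChar_mul_self_eq_prod_bracket`, aggregated by `stdAddChar_mul_eq_prod_linear` /
`stdAddChar_mul_self_eq_prod_monomials`); the indicator of `B(S',ρ₆)` is then replaced by the product of
the cutoffs `χ(ξ_l u)` carried by the monomials (`norm_sum_bohr_sub_sum_weight_le`).  The output is a
correlation `(k/64) #B(S',ρ₆) ≤ ‖∑_u f(u+t₁) G(u)‖` with `G` an explicit finite product of the elementary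
factors realised as Heisenberg-class nilsequences in `…UniformRealisations` / `…TensorUniform`.  Def-free:

* `prod_weight_mul`, `prod_prod_weight_mul` — pulling the real cutoff weights out of the products;
* `exists_factorised_bracket_correlation` — the statement described above.

References: [GreenTao2008U3Inverse] arXiv:math/0503014, §10 Prop. 54, §12 proof of Thm. 68.
-/

noncomputable section

namespace Summit.Parity.GeneralizedHardyLittlewood.GreenTaoLevelTwoGITwoCyclicInverse

open Finset ZMod
open Literature.NumberTheory.Sieve Literature.Algebra.EuclideanLattices

/-- Pulling a real weight out of a product: `∏_l (κ_l · T_l) = (∏_l κ_l) · ∏_l T_l`. [folklore] -/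
theorem prod_weight_mul {d : ℕ} (κv : Fin d → ℝ) (T : Fin d → ℂ) :
    ∏ l, ((κv l : ℂ) * T l) = ((∏ l, κv l : ℝ) : ℂ) * ∏ l, T l := by
  rw [Complex.ofReal_prod, ← Finset.prod_mul_distrib]

/-- Pulling the real weights out of a double product:
`∏_{l,l'} (κ_lκ_{l'})·((κ_lκ_{l'})·T_{ll'}) = (∏_{l,l'} (κ_lκ_{l'})²) · ∏_{l,l'} T_{ll'}`. [folklore] -/
theorem prod_prod_weight_mul {d : ℕ} (κv : Fin d → ℝ) (T : Fin d → Fin d → ℂ) :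
    ∏ l, ∏ l', (((κv l : ℂ) * (κv l' : ℂ)) * (((κv l : ℂ) * (κv l' : ℂ)) * T l l')) =
      ((∏ l, ∏ l', (κv l * κv l') * (κv l * κv l') : ℝ) : ℂ) * ∏ l, ∏ l', T l l' := by
  rw [Complex.ofReal_prod, ← Finset.prod_mul_distrib]
  refine Finset.prod_congr rfl fun l _ => ?_
  rw [Complex.ofReal_prod, ← Finset.prod_mul_distrib]
  refine Finset.prod_congr rfl fun l' _ => ?_
  push_cast; ring

/-- **The localised quadratic correlation in factorised bracket form (arXiv §12, proof of Thm. 68).**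
Let `N` be prime, `ξ : Fin d → ℤ/Nℤ` an enumeration of `S'` with `ξ l₀ = 1`, `μ` additive on
`B₄ = B(S',ρ₄)`, `x₀ ∈ B₄`, `y ∈ B(S',ρ₅)`, `0 < ρ₆ ≤ 1/8` with `ρ₅ + 2ρ₆ ≤ ρ₄` and
`2ρ₆ · 2^{d(d+2)} d² < ρ₄`, `B(S',ρ₆)` regular, `0 < k ≤ 1`, `|f| ≤ 1` and
`(k/32) #B(S',ρ₆) ≤ ‖∑_{u∈B(S',ρ₆)} f(y+u+t) e(cμ(x₀+(y+u))(x₀+(y+u))) e((y+u)ζ)‖`.  Then there are a cutoff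
`κ : ℝ/ℤ → [0,1]` vanishing on `‖a‖ ≥ r₂` (`r₂ ≤ 1/4`) and `(6400 d'/(kρ₆))`-Lipschitz (`d' = #S'`), real
coefficients `A_{ll'}`, `B_l`, and `ζ₁, t₁` with
`(k/64) #B(S',ρ₆) ≤ ‖∑_u f(u+t₁) · e(uζ₁) · ∏_l κ(uξ_l)e(B_l{uξ_l/N}) · ∏_{l,l'} κ(uξ_l)κ(uξ_{l'})·(κ(uξ_l)κ(uξ_{l'})
e(A_{ll'}{uξ_l/N}{uξ_{l'}/N}))‖`.
[cite: GreenTao2008U3Inverse, §10 Prop. 54 and §12, proof of Thm. 68] -/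
theorem exists_factorised_bracket_correlation {N : ℕ} [NeZero N] (hN : N.Prime) {d : ℕ}
    (S' : Finset (ZMod N)) (ξ : Fin d → ZMod N) (hS' : ∀ s, s ∈ S' ↔ ∃ l, ξ l = s) (l₀ : Fin d)
    (hl₀ : ξ l₀ = 1) (c : ZMod N) (μ : ZMod N → ZMod N) {ρ₄ ρ₅ ρ₆ k : ℝ} (hρ₄ : 0 < ρ₄)
    (hadd : ∀ x ∈ ({v : ZMod N | ∀ ξ ∈ S', ‖ZMod.toAddCircle (v * ξ)‖ < ρ₄} : Finset (ZMod N)),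
      ∀ h ∈ ({v : ZMod N | ∀ ξ ∈ S', ‖ZMod.toAddCircle (v * ξ)‖ < ρ₄} : Finset (ZMod N)),
        μ (x + h) = μ x + μ h)
    {x₀ y : ZMod N}
    (hx₀ : x₀ ∈ ({v : ZMod N | ∀ ξ ∈ S', ‖ZMod.toAddCircle (v * ξ)‖ < ρ₄} : Finset (ZMod N)))
    (hy : y ∈ ({v : ZMod N | ∀ ξ ∈ S', ‖ZMod.toAddCircle (v * ξ)‖ < ρ₅} : Finset (ZMod N)))
    (hρ₆ : 0 < ρ₆) (hρ₆8 : ρ₆ ≤ 1 / 8) (hρ : ρ₅ + 2 * ρ₆ ≤ ρ₄)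
    (hbr : 2 * ρ₆ * (2 ^ (d * (d + 2)) * d * d) < ρ₄)
    (hreg₆ : ∀ r : ℝ, |r| ≤ 1 / (100 * (#S' : ℝ)) →
      (1 - 100 * (#S' : ℝ) * |r|) * #{x : ZMod N | ∀ ξ ∈ S', ‖ZMod.toAddCircle (x * ξ)‖ < ρ₆} ≤
          #{x : ZMod N | ∀ ξ ∈ S', ‖ZMod.toAddCircle (x * ξ)‖ < (1 + r) * ρ₆} ∧
        (#{x : ZMod N | ∀ ξ ∈ S', ‖ZMod.toAddCircle (x * ξ)‖ < (1 + r) * ρ₆} : ℝ) ≤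
          (1 + 100 * (#S' : ℝ) * |r|) * #{x : ZMod N | ∀ ξ ∈ S', ‖ZMod.toAddCircle (x * ξ)‖ < ρ₆})
    (hk0 : 0 < k) (hk1 : k ≤ 1) (f : ZMod N → ℝ) (hf : ∀ x, |f x| ≤ 1) (t ζ : ZMod N)
    (hcorr : k / 32 * #{x : ZMod N | ∀ ξ ∈ S', ‖ZMod.toAddCircle (x * ξ)‖ < ρ₆} ≤
      ‖∑ u ∈ ({x : ZMod N | ∀ ξ ∈ S', ‖ZMod.toAddCircle (x * ξ)‖ < ρ₆} : Finset (ZMod N)),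
        ((f (y + u + t) : ℝ) : ℂ) * stdAddChar (c * μ (x₀ + (y + u)) * (x₀ + (y + u))) *
          stdAddChar ((y + u) * ζ)‖) :
    ∃ (κ : AddCircle (1 : ℝ) → ℝ) (r₂ : ℝ) (A : Fin d → Fin d → ℝ) (B : Fin d → ℝ) (ζ₁ t₁ : ZMod N),
      (∀ a, 0 ≤ κ a ∧ κ a ≤ 1) ∧ (∀ a, r₂ ≤ ‖a‖ → κ a = 0) ∧ r₂ ≤ 1 / 4 ∧
      (∀ a b, |κ a - κ b| ≤ (6400 * (#S' : ℝ) / (k * ρ₆)) * dist a b) ∧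
      k / 64 * #{x : ZMod N | ∀ ξ ∈ S', ‖ZMod.toAddCircle (x * ξ)‖ < ρ₆} ≤
        ‖∑ u : ZMod N, ((f (u + t₁) : ℝ) : ℂ) *
          (((AddCircle.toCircle (ZMod.toAddCircle (u * ζ₁)) : Circle) : ℂ) *
            (∏ l, (κ (ZMod.toAddCircle (u * ξ l)) : ℂ) *
              ((AddCircle.toCircle (((B l * (((u * ξ l).valMinAbs : ℝ) / N) : ℝ)) :
                AddCircle (1 : ℝ)) : Circle) : ℂ)) *
            ∏ l, ∏ l', ((κ (ZMod.toAddCircle (u * ξ l)) : ℂ) * (κ (ZMod.toAddCircle (u * ξ l')) : ℂ)) *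
              (((κ (ZMod.toAddCircle (u * ξ l)) : ℂ) * (κ (ZMod.toAddCircle (u * ξ l')) : ℂ)) *
                ((AddCircle.toCircle (((A l l' * (((u * ξ l).valMinAbs : ℝ) / N) *
                  (((u * ξ l').valMinAbs : ℝ) / N) : ℝ)) : AddCircle (1 : ℝ)) : Circle) : ℂ)))‖ := by
  classical
  haveI : Fact N.Prime := ⟨hN⟩
  have hNpos : (0 : ℝ) < N := by exact_mod_cast hN.pos
  -- translation between `S'` and the enumeration `ξ`
  have hall : ∀ {Q : ZMod N → Prop}, (∀ s ∈ S', Q s) ↔ ∀ l, Q (ξ l) := by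
    intro Q
    constructor
    · intro h l; exact h _ ((hS' _).2 ⟨l, rfl⟩)
    · intro h s hs; obtain ⟨l, rfl⟩ := (hS' s).1 hs; exact h l
  have hmem : ∀ {r : ℝ} {x : ZMod N},
      x ∈ ({v : ZMod N | ∀ ξ ∈ S', ‖ZMod.toAddCircle (v * ξ)‖ < r} : Finset (ZMod N)) ↔
        ∀ l, ‖ZMod.toAddCircle (x * ξ l)‖ < r := by
    intro r x; rw [mem_filter]; simp only [mem_univ, true_and]; exact hall
  have hd1 : (1 : ℝ) ≤ d := by have : 0 < d := Fin.pos l₀; exact_mod_cast this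
  have hd'1 : (1 : ℝ) ≤ #S' := by
    have : (1 : ZMod N) ∈ S' := (hS' 1).2 ⟨l₀, hl₀⟩
    exact_mod_cast Nat.one_le_iff_ne_zero.mpr (card_pos.mpr ⟨1, this⟩).ne'
  have hd'0 : (0 : ℝ) < #S' := by linarith
  have hξ0 : ξ l₀ ≠ 0 := by rw [hl₀]; exact one_ne_zero
  -- the cutoff
  obtain ⟨ε₆, hε₆⟩ : ∃ ε₆ : ℝ, ε₆ = k / (12800 * (#S' : ℝ)) := ⟨_, rfl⟩
  have hε₆0 : 0 < ε₆ := by rw [hε₆]; positivity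
  have hε₆1 : ε₆ ≤ 1 := by
    rw [hε₆, div_le_one (by positivity)]; nlinarith
  have hε₆100 : ε₆ ≤ 1 / (100 * (#S' : ℝ)) := by
    rw [hε₆, div_le_div_iff₀ (by positivity) (by positivity)]; nlinarith
  have h200 : 200 * (#S' : ℝ) * ε₆ = k / 64 := by rw [hε₆]; field_simp; ring
  have hr12 : (1 - ε₆) * ρ₆ < (1 + ε₆) * ρ₆ := by nlinarith
  obtain ⟨κ, hκ, hκL, hκ1, hκ0⟩ := exists_circle_cutoff hr12
  have hkne : k ≠ 0 := hk0.ne'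
  have hLκ : 1 / ((1 + ε₆) * ρ₆ - (1 - ε₆) * ρ₆) = 6400 * (#S' : ℝ) / (k * ρ₆) := by
    have e : (1 + ε₆) * ρ₆ - (1 - ε₆) * ρ₆ = k * ρ₆ / (6400 * (#S' : ℝ)) := by
      rw [hε₆]; field_simp; ring
    rw [e, one_div_div]
  rw [hLκ] at hκL
  have hr₂ : (1 + ε₆) * ρ₆ ≤ 2 * ρ₆ := by nlinarith
  have hr₂4 : (1 + ε₆) * ρ₆ ≤ 1 / 4 := by linarith
  -- the bracket data (arXiv §10)
  obtain ⟨w, v, hli, hv, hcoord⟩ := exists_bohr_lattice_generators ξ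
  obtain ⟨a, ha⟩ := exists_dual_coeffs w hli
  have hbig1 : (1 : ℝ) ≤ 2 ^ (d * (d + 2)) * d * d := by
    have h1 : (1 : ℝ) ≤ 2 ^ (d * (d + 2)) := one_le_pow₀ (by norm_num)
    calc (1 : ℝ) = 1 * 1 * 1 := by ring
      _ ≤ 2 ^ (d * (d + 2)) * d * d := by gcongr
  have hr₂ρ₄ : (1 + ε₆) * ρ₆ < ρ₄ := by
    calc (1 + ε₆) * ρ₆ ≤ 2 * ρ₆ := hr₂
      _ = 2 * ρ₆ * 1 := (mul_one _).symm
      _ ≤ 2 * ρ₆ * (2 ^ (d * (d + 2)) * d * d) := by gcongr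
      _ < ρ₄ := hbr
  have hbr' : (1 + ε₆) * ρ₆ * (2 ^ (d * (d + 2)) * d * d) < ρ₄ :=
    lt_of_le_of_lt (mul_le_mul_of_nonneg_right hr₂ (by positivity)) hbr
  -- additivity of `u ↦ c μ u` in the form used by Prop. 54
  have hadd' : ∀ a' b' : ZMod N, (∀ l, ‖ZMod.toAddCircle (a' * ξ l)‖ < ρ₄) →
      (∀ l, ‖ZMod.toAddCircle (b' * ξ l)‖ < ρ₄) →
      (∀ l, ‖ZMod.toAddCircle ((a' + b') * ξ l)‖ < ρ₄) →
      (fun u => c * μ u) (a' + b') = (fun u => c * μ u) a' + (fun u => c * μ u) b' := by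
    intro a' b' ha' hb' _
    show c * μ (a' + b') = c * μ a' + c * μ b'
    rw [hadd a' (hmem.2 ha') b' (hmem.2 hb'), mul_add]
  -- membership facts
  have hyl : ∀ l, ‖ZMod.toAddCircle (y * ξ l)‖ < ρ₅ := hmem.1 hy
  have hy₄ : y ∈ ({v : ZMod N | ∀ ξ ∈ S', ‖ZMod.toAddCircle (v * ξ)‖ < ρ₄} : Finset (ZMod N)) :=
    hmem.2 fun l => (hyl l).trans_le (by linarith)
  have hu₄ : ∀ {u : ZMod N}, (∀ l, ‖ZMod.toAddCircle (u * ξ l)‖ < (1 + ε₆) * ρ₆) →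
      u ∈ ({v : ZMod N | ∀ ξ ∈ S', ‖ZMod.toAddCircle (v * ξ)‖ < ρ₄} : Finset (ZMod N)) :=
    fun hu => hmem.2 fun l => (hu l).trans hr₂ρ₄
  have hyu₄ : ∀ {u : ZMod N}, (∀ l, ‖ZMod.toAddCircle (u * ξ l)‖ < (1 + ε₆) * ρ₆) →
      y + u ∈ ({v : ZMod N | ∀ ξ ∈ S', ‖ZMod.toAddCircle (v * ξ)‖ < ρ₄} : Finset (ZMod N)) := by
    intro u hu
    refine hmem.2 fun l => ?_
    rw [add_mul, map_add]
    calc ‖ZMod.toAddCircle (y * ξ l) + ZMod.toAddCircle (u * ξ l)‖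
        ≤ ‖ZMod.toAddCircle (y * ξ l)‖ + ‖ZMod.toAddCircle (u * ξ l)‖ := norm_add_le _ _
      _ < ρ₅ + 2 * ρ₆ := add_lt_add_of_lt_of_le (hyl l) ((hu l).le.trans hr₂)
      _ ≤ ρ₄ := hρ
  -- names for the output data
  set z : ZMod N := x₀ + y with hz
  set ζ₁ : ZMod N := c * (μ x₀ + μ y) + ζ with hζ₁
  set t₁ : ZMod N := y + t with ht₁
  set C : ℂ := (stdAddChar (c * (μ x₀ + μ y) * (x₀ + y)) : ℂ) * stdAddChar (y * ζ) with hC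
  have hC1 : ‖C‖ = 1 := by rw [hC, norm_mul, norm_stdAddChar, norm_stdAddChar, mul_one]
  set A : Fin d → Fin d → ℝ := fun l l' =>
    N * ∑ i, ∑ j, a i l * a j l' * (((fun u => c * μ u) (v i) * v j).valMinAbs : ℝ) with hA
  set B : Fin d → ℝ := fun l => ∑ j, a j l * (((fun u => c * μ u) (v j) * z).valMinAbs : ℝ) with hB
  -- the weight and the original summand
  set κv : ZMod N → Fin d → ℝ := fun u l => κ (ZMod.toAddCircle (u * ξ l)) with hκv
  set P : ZMod N → ℝ := fun u => (∏ l, κv u l) * ∏ l, ∏ l', (κv u l * κv u l') * (κv u l * κv u l')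
    with hP
  set g : ZMod N → ℂ := fun u => ((f (y + u + t) : ℝ) : ℂ) *
    stdAddChar (c * μ (x₀ + (y + u)) * (x₀ + (y + u))) * stdAddChar ((y + u) * ζ) with hg
  have hg1 : ∀ u, ‖g u‖ ≤ 1 := fun u => by
    rw [hg]; simp only
    rw [norm_mul, norm_mul, norm_stdAddChar, norm_stdAddChar, mul_one, mul_one, Complex.norm_real,
      Real.norm_eq_abs]
    exact hf _
  -- the factorised function
  set T₁ : ZMod N → Fin d → ℂ := fun u l =>
    ((AddCircle.toCircle (((B l * (((u * ξ l).valMinAbs : ℝ) / N) : ℝ)) : AddCircle (1 : ℝ)) :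
      Circle) : ℂ) with hT₁
  set T₂ : ZMod N → Fin d → Fin d → ℂ := fun u l l' =>
    ((AddCircle.toCircle (((A l l' * (((u * ξ l).valMinAbs : ℝ) / N) *
      (((u * ξ l').valMinAbs : ℝ) / N) : ℝ)) : AddCircle (1 : ℝ)) : Circle) : ℂ) with hT₂
  set Gf : ZMod N → ℂ := fun u =>
    ((AddCircle.toCircle (ZMod.toAddCircle (u * ζ₁)) : Circle) : ℂ) *
      (∏ l, (κv u l : ℂ) * T₁ u l) *
      ∏ l, ∏ l', ((κv u l : ℂ) * (κv u l' : ℂ)) * (((κv u l : ℂ) * (κv u l' : ℂ)) * T₂ u l l')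
    with hGf
  -- pointwise identity `P u · g u = C · f(u+t₁) · Gf u`
  have hpoint : ∀ u, (P u : ℂ) * g u = C * (((f (u + t₁) : ℝ) : ℂ) * Gf u) := by
    intro u
    by_cases hu : ∀ l, ‖ZMod.toAddCircle (u * ξ l)‖ < (1 + ε₆) * ρ₆
    · -- inside: split the phase and expand the brackets
      obtain ⟨cu, hxu, hμu, hdual, -⟩ := stdAddChar_mul_self_eq_prod_bracket ξ l₀ hξ0 hv hcoord ha
        hρ₄ hbr' (fun u => c * μ u) hadd' hu
      have hE₃ := stdAddChar_mul_self_eq_prod_monomials ξ cu v (fun u => c * μ u) hxu hμu hdual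
      have hE₂ := stdAddChar_mul_eq_prod_linear ξ cu v (fun u => c * μ u) z hμu hdual
      have hsplit := stdAddChar_local_phase_split S' μ hadd c hx₀ hy₄ (hu₄ hu) (hyu₄ hu) ζ
      have hgu : g u = ((f (u + t₁) : ℝ) : ℂ) * (C * ((stdAddChar (u * ζ₁) : ℂ) *
          stdAddChar (c * μ u * z) * stdAddChar (c * μ u * u))) := by
        rw [hg]; simp only
        rw [mul_assoc, hsplit, ht₁, hC, hζ₁, hz]
        congr 2; ring
      have hPu : (P u : ℂ) = ((∏ l, κv u l : ℝ) : ℂ) *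
          ((∏ l, ∏ l', (κv u l * κv u l') * (κv u l * κv u l') : ℝ) : ℂ) := by
        rw [hP]; simp only; rw [Complex.ofReal_mul]
      have hGfu : Gf u = (stdAddChar (u * ζ₁) : ℂ) * (((∏ l, κv u l : ℝ) : ℂ) * ∏ l, T₁ u l) *
          (((∏ l, ∏ l', (κv u l * κv u l') * (κv u l * κv u l') : ℝ) : ℂ) * ∏ l, ∏ l', T₂ u l l') := by
        rw [hGf]; simp only
        rw [prod_weight_mul, prod_prod_weight_mul, stdAddChar_eq_toCircle]
      have hE₂' : (stdAddChar (c * μ u * z) : ℂ) = ∏ l, T₁ u l := by rw [hE₂]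
      have hE₃' : (stdAddChar (c * μ u * u) : ℂ) = ∏ l, ∏ l', T₂ u l l' := by rw [hE₃]
      rw [hgu, hPu, hGfu, hE₂', hE₃']
      ring
    · -- outside: both sides vanish
      push Not at hu
      obtain ⟨l, hl⟩ := hu
      have hκl : κv u l = 0 := by rw [hκv]; exact hκ0 _ hl
      have hPu : P u = 0 := by
        rw [hP]; simp only
        rw [Finset.prod_eq_zero (Finset.mem_univ l) hκl, zero_mul]
      have hGfu : Gf u = 0 := by
        rw [hGf]; simp only
        have : ∏ l, (κv u l : ℂ) * T₁ u l = 0 :=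
          Finset.prod_eq_zero (Finset.mem_univ l) (by rw [hκl]; simp)
        rw [this, mul_zero, zero_mul]
      rw [hPu, hGfu]; simp
  -- the weight is admissible for the smoothing lemma
  have hκv01 : ∀ u l, 0 ≤ κv u l ∧ κv u l ≤ 1 := fun u l => hκ _
  have hP01 : ∀ u, 0 ≤ P u ∧ P u ≤ 1 := by
    intro u
    rw [hP]; simp only
    have h1 : 0 ≤ ∏ l, κv u l := Finset.prod_nonneg fun l _ => (hκv01 u l).1
    have h2 : ∏ l, κv u l ≤ 1 :=
      Finset.prod_le_one (fun l _ => (hκv01 u l).1) fun l _ => (hκv01 u l).2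
    have hq0 : ∀ l l', 0 ≤ (κv u l * κv u l') * (κv u l * κv u l') := fun l l' => by
      have := (hκv01 u l).1; have := (hκv01 u l').1; positivity
    have hq1 : ∀ l l', (κv u l * κv u l') * (κv u l * κv u l') ≤ 1 := fun l l' => by
      have ha1 : κv u l * κv u l' ≤ 1 := by
        calc κv u l * κv u l' ≤ 1 * 1 :=
              mul_le_mul (hκv01 u l).2 (hκv01 u l').2 (hκv01 u l').1 zero_le_one
          _ = 1 := one_mul 1
      have ha0 : 0 ≤ κv u l * κv u l' := mul_nonneg (hκv01 u l).1 (hκv01 u l').1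
      calc (κv u l * κv u l') * (κv u l * κv u l') ≤ 1 * 1 := mul_le_mul ha1 ha1 ha0 zero_le_one
        _ = 1 := one_mul 1
    have h3 : 0 ≤ ∏ l, ∏ l', (κv u l * κv u l') * (κv u l * κv u l') :=
      Finset.prod_nonneg fun l _ => Finset.prod_nonneg fun l' _ => hq0 l l'
    have h4 : ∏ l, ∏ l', (κv u l * κv u l') * (κv u l * κv u l') ≤ 1 :=
      Finset.prod_le_one (fun l _ => Finset.prod_nonneg fun l' _ => hq0 l l')
        fun l _ => Finset.prod_le_one (fun l' _ => hq0 l l') fun l' _ => hq1 l l'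
    exact ⟨mul_nonneg h1 h3, by
      calc (∏ l, κv u l) * ∏ l, ∏ l', (κv u l * κv u l') * (κv u l * κv u l') ≤ 1 * 1 :=
            mul_le_mul h2 h4 h3 zero_le_one
        _ = 1 := one_mul 1⟩
  have hP1 : ∀ u, (∀ s ∈ S', ‖ZMod.toAddCircle (u * s)‖ < (1 - ε₆) * ρ₆) → P u = 1 := by
    intro u hu
    have hu' : ∀ l, κv u l = 1 := fun l => by
      rw [hκv]; exact hκ1 _ (hall.1 hu l).le
    rw [hP]; simp only [hu']
    simp
  have hP0 : ∀ u, (∃ s ∈ S', (1 + ε₆) * ρ₆ ≤ ‖ZMod.toAddCircle (u * s)‖) → P u = 0 := by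
    rintro u ⟨s, hs, hsu⟩
    obtain ⟨l, rfl⟩ := (hS' s).1 hs
    have hκl : κv u l = 0 := by rw [hκv]; exact hκ0 _ hsu
    rw [hP]; simp only
    rw [Finset.prod_eq_zero (Finset.mem_univ l) hκl, zero_mul]
  -- smoothing
  have hsmooth := norm_sum_bohr_sub_sum_weight_le S' hρ₆ hε₆0 hε₆100 hreg₆ P hP01 hP1 hP0 g hg1
  rw [h200] at hsmooth
  have hsumP : ∑ u : ZMod N, (P u : ℂ) * g u = C * ∑ u : ZMod N, ((f (u + t₁) : ℝ) : ℂ) * Gf u := by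
    rw [Finset.mul_sum]; exact Finset.sum_congr rfl fun u _ => hpoint u
  refine ⟨κ, (1 + ε₆) * ρ₆, A, B, ζ₁, t₁, hκ, hκ0, hr₂4, hκL, ?_⟩
  -- the final inequality
  have hcorr' : k / 32 * #{x : ZMod N | ∀ ξ ∈ S', ‖ZMod.toAddCircle (x * ξ)‖ < ρ₆} ≤
      ‖∑ u ∈ ({x : ZMod N | ∀ ξ ∈ S', ‖ZMod.toAddCircle (x * ξ)‖ < ρ₆} : Finset (ZMod N)), g u‖ := by
    rw [hg]; exact hcorr
  have hnorm : ‖∑ u : ZMod N, (P u : ℂ) * g u‖ = ‖∑ u : ZMod N, ((f (u + t₁) : ℝ) : ℂ) * Gf u‖ := by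
    rw [hsumP, norm_mul, hC1, one_mul]
  have htri := norm_sub_norm_le
    (∑ u ∈ ({x : ZMod N | ∀ ξ ∈ S', ‖ZMod.toAddCircle (x * ξ)‖ < ρ₆} : Finset (ZMod N)), g u)
    (∑ u : ZMod N, (P u : ℂ) * g u)
  have hfinal : k / 64 * #{x : ZMod N | ∀ ξ ∈ S', ‖ZMod.toAddCircle (x * ξ)‖ < ρ₆} ≤
      ‖∑ u : ZMod N, ((f (u + t₁) : ℝ) : ℂ) * Gf u‖ := by
    rw [← hnorm]; linarith
  rw [hGf] at hfinal
  exact hfinal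

end Summit.Parity.GeneralizedHardyLittlewood.GreenTaoLevelTwoGITwoCyclicInverse
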